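import Summits.Ventures.PercRepro2.CaseOnePocketConn

/-!
# Connections through a pocket, in the outside and the inside configurations
(blind cell PercRepro2, p1 g27; the two connection facts behind the second pocket reduction)

For a pocket `(W, x, P)`: a connection between two vertices outside `W` is a connection of the outside
configuration `outOnly P ω` (`conn_outOnly_iff`), and a connection from a vertex `z ∈ W` to a vertex
outside is «`z ↔ x` through `P`» (the inside configuration `inOnly P ω`) and «`x ↔ v` outside»
(`conn_of_mem_iff`). Both by the closure lemma `mem_of_conn_of_closed` with an explicit closed vertex
set. Own code; standard axioms. -/

namespace Summit.Ventures.PercRepro2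

namespace CaseOne

/-! ## Connections through a pocket -/

section PocketConnG
variable {V : Type*} {E : Type*} [DecidableEq E] {ends : E → Sym2 V} {W : Set V} {x : V}
  {P : Finset E} (ω : Config E)

/-- **Connections between outside vertices live in the outside configuration.** -/
theorem conn_outOnly_iff (h : IsPocket ends W x P) {u v : V} (hu : u ∉ W) (hv : v ∉ W) :
    Conn ends ω u v ↔ Conn ends (outOnly P ω) u v := by
  constructor
  · intro huv
    let S : Set V := {y | (y ∉ W ∧ Conn ends (outOnly P ω) u y) ∨
      (y ∈ W ∧ Conn ends (outOnly P ω) u x)}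
    have hS : ∀ y ∈ S, ∀ z, (openGraph ends ω).Adj y z → z ∈ S := by
      intro y hy z hadj
      rw [openGraph_adj] at hadj
      obtain ⟨-, e, hopen, hends⟩ := hadj
      have hye : y ∈ ends e := by rw [hends]; exact Sym2.mem_mk_left y z
      have hze : z ∈ ends e := by rw [hends]; exact Sym2.mem_mk_right y z
      rcases hy with ⟨hyW, hcy⟩ | ⟨hyW, hcx⟩
      · by_cases hzW : z ∈ W
        · have heP : e ∈ P := h.mem_P hzW hze
          have hyx : y = x := h.eq_x heP hye hyW
          exact Or.inr ⟨hzW, hyx ▸ hcy⟩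
        · have heP : e ∉ P := h.not_mem_P_of_ends hends hyW hzW
          have hopen' : outOnly P ω e = true := by simp [heP, hopen]
          exact Or.inl ⟨hzW, conn_trans hcy (conn_of_openAdj ⟨e, hopen', hends⟩)⟩
      · have heP : e ∈ P := h.mem_P hyW hye
        rcases h.ends_mem e heP z hze with hzW | hzx
        · exact Or.inr ⟨hzW, hcx⟩
        · exact Or.inl ⟨hzx ▸ h.x_not_mem, hzx ▸ hcx⟩
    have hvS : v ∈ S := mem_of_conn_of_closed hS (Or.inl ⟨hu, conn_refl _ _ u⟩) huv
    rcases hvS with ⟨-, hcv⟩ | ⟨hvW, -⟩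
    · exact hcv
    · exact absurd hvW hv
  · exact conn_mono (outOnly_le P ω)

/-- **A connection from inside the pocket to the outside factors through the cut vertex**: «`z ↔ x`
through `P`» and «`x ↔ v` outside». -/
theorem conn_of_mem_iff (h : IsPocket ends W x P) {z v : V} (hz : z ∈ W) (hv : v ∉ W) :
    Conn ends ω z v ↔ (Conn ends (inOnly P ω) z x ∧ Conn ends (outOnly P ω) x v) := by
  constructor
  · intro hzv
    let S : Set V := {y | (y ∈ W ∧ Conn ends (inOnly P ω) z y) ∨
      (y ∉ W ∧ Conn ends (inOnly P ω) z x ∧ Conn ends (outOnly P ω) x y)}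
    have hS : ∀ y ∈ S, ∀ z', (openGraph ends ω).Adj y z' → z' ∈ S := by
      intro y hy z' hadj
      rw [openGraph_adj] at hadj
      obtain ⟨-, e, hopen, hends⟩ := hadj
      have hye : y ∈ ends e := by rw [hends]; exact Sym2.mem_mk_left y z'
      have hz'e : z' ∈ ends e := by rw [hends]; exact Sym2.mem_mk_right y z'
      rcases hy with ⟨hyW, hcy⟩ | ⟨hyW, hcx, hcy⟩
      · have heP : e ∈ P := h.mem_P hyW hye
        have hopen' : inOnly P ω e = true := by simp [heP, hopen]
        have hcz' : Conn ends (inOnly P ω) z z' :=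
          conn_trans hcy (conn_of_openAdj ⟨e, hopen', hends⟩)
        rcases h.ends_mem e heP z' hz'e with hz'W | hz'x
        · exact Or.inl ⟨hz'W, hcz'⟩
        · exact Or.inr ⟨hz'x ▸ h.x_not_mem, hz'x ▸ hcz', hz'x ▸ conn_refl _ _ _⟩
      · by_cases hz'W : z' ∈ W
        · have heP : e ∈ P := h.mem_P hz'W hz'e
          have hyx : y = x := h.eq_x heP hye hyW
          have hopen' : inOnly P ω e = true := by simp [heP, hopen]
          exact Or.inl ⟨hz'W, conn_trans hcx (hyx ▸ conn_of_openAdj ⟨e, hopen', hends⟩)⟩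
        · have heP : e ∉ P := h.not_mem_P_of_ends hends hyW hz'W
          have hopen' : outOnly P ω e = true := by simp [heP, hopen]
          exact Or.inr ⟨hz'W, hcx, conn_trans hcy (conn_of_openAdj ⟨e, hopen', hends⟩)⟩
    have hvS : v ∈ S := mem_of_conn_of_closed hS (Or.inl ⟨hz, conn_refl _ _ z⟩) hzv
    rcases hvS with ⟨hvW, -⟩ | ⟨-, hcx, hcv⟩
    · exact absurd hvW hv
    · exact ⟨hcx, hcv⟩
  · rintro ⟨hcx, hcv⟩
    exact conn_trans (conn_mono (inOnly_le P ω) hcx) (conn_mono (outOnly_le P ω) hcv)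

end PocketConnG

end CaseOne

end Summit.Ventures.PercRepro2
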